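import Literature.Geometry.Riemannian.MetricFlowConcentration
import Literature.Geometry.Riemannian.RicciFlow
import Literature.Geometry.Riemannian.RicciFlowScalarMaximumPrinciple
import Literature.Geometry.Riemannian.RiemannianDistance
import Literature.Geometry.Lorentzian.Volume
import Mathlib.Analysis.SpecialFunctions.Log.ENNRealLog
import Mathlib.Data.EReal.Inv
import HarnessLib

/-!
# Ricci flow through singularities in dimension 4, as a metric flow: Bamler's vocabulary
# (flow isometries, `H`-concentration, parabolic rescaling, `𝔽`-distance, tangent flows,
# regular and singular part) and the object of Bamler's Conjecture 5.8

A 4-dimensional "Ricci flow through singularities" started from a closed Riemannian 4-manifold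
`(M, g₀)` is the conjectural object of R. Bamler, *Recent developments in Ricci flows*, Notices
AMS 68 (2021), §5.6, **Conjecture 5.8**: "Given a closed Riemannian 4-manifold `(M, g)` there is a
certain kind of 'Ricci flow through singularities' in which topological change occurs along
cylinders or cones and in which time-slices are allowed to have isolated orbifold singularities."
No precise definition is printed in dimension 4 (in dimension 3 the notion is the singular Ricci
flow of Kleiner–Lott and Bamler–Kleiner, Notices Defs. 4.7–4.10 / Thm. 4.6, which is a smooth
Ricci flow SPACETIME, and which Bamler 2023, §3.7 converts into an `H₃`-concentrated METRIC FLOW);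
what is printed precisely, and vendored here as real definitions over the tree's
`Literature.Geometry.Riemannian.MetricFlow` (Bamler 2023, Def. 3.2, landed in `MetricFlow.lean`),
is the vocabulary of R. Bamler, *Compactness theory of the space of super Ricci flows*, Invent.
Math. 233 (2023) in which the 4-dimensional picture (Notices §5.3–5.5: metric flows with a
regular–singular decomposition, tangent flows that are possibly singular gradient shrinking
solitons, isolated orbifold points in time-slices) is formulated:

* §3.1: `MetricFlow.FlowIsometry` (Def. (Isometry between metric flows)), `IsFlowIsometricOver`,
  `IsAEFlowIsometric`; the time-shift-and-parabolic-rescaling `MetricFlow.rescale` = `𝒳^{−ΔT,λ}`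
  (Lemma (parabolic rescaling); notation of §6.8), a CONSTRUCTION (the printed lemma's proof
  obligations are discharged: the gradient property rescales `T ↦ T/λ²`), over the type synonym
  `ScaledDist λ X` (distances multiplied by `λ`, same uniformity/σ-algebra);
* §3.4/§3.7: `concentrationConst n = H_n = (n−1)π²/2 + 4` (§3.7, Theorem) for the tree's
  `MetricFlow.IsHConcentrated` (`MetricFlowConcentration.lean`, which also provides the couplings,
  `d_{W₁}` = `wassersteinW1` and `Var` = `variance` of §2.1–2.2 used throughout);
* §3.3, §3.5–3.6: `MetricFlow.pParabolicNhd`, `pParabolicBall` (`P*`-parabolic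
  neighbourhoods/balls), `coveringNumber` and `minkowskiDimStar` (Def. (Minkowski dimension):
  `dim_{𝓜*}`, the dimension of "the singular set has parabolic codimension `≥ 4`", Notices
  Thm. 5.4), `MetricFlow.naturalTopology` (Def. (natural topology); a `TopologicalSpace 𝒳.Pt`,
  not an instance);
* §5.1: `MetricFlow.FlowPair` (metric flow pairs over `I`), `MetricFlow.Correspondence`,
  `MetricFlow.FDistWithin` (`d_𝔽^{ℭ,J}`), `MetricFlow.FDist` / `FlowPair.fdist` (`d_𝔽^J`),
  `FlowPair.FConverges` (`d_𝔽^J → 0`);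
* §6.8: `MetricFlow.IsTangentFlowAt` (Def. (Tangent flow): `𝔽`-limits in `𝔽*_{(−∞,0]}` of the
  rescalings `𝒳^{−t₀,λ_k}`, `λ_k → ∞`, based at `x₀`, on every `[−T, 0]`),
  `IsTangentFlowAtInfinity` (`λ_k → 0`);
* §9.2: `MetricFlow.RegularChart` / `IsRegularPoint` (Def. (Regular points), all five clauses, over
  the tree's classical Ricci flows `IsRicciFlow g' cov' I'` (`RicciFlow.lean`), Riemannian
  distance `PseudoRiemannianMetric.edist` (`RiemannianDistance.lean`), Laplace–Beltrami operator
  `laplaceBeltrami` (`RicciFlowScalarMaximumPrinciple.lean`), `scalarCurvatureWith`, and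
  Riemannian measure `Lorentzian.riemannianMeasure` (`Lorentzian/Volume.lean`)),
  `regularPart` (`ℛ`), `singularPart` (`𝒮 = 𝒳 ∖ ℛ`), `localDim`, `singularTimes` (times whose
  slice meets `𝒮`), and `IsModelledOn` (a regular chart with bijective globally isometric slice
  maps: "`𝒳_{I'}` is the metric flow of the classical flow `(M, g_t)`", the predicate naming
  smooth models such as the round shrinking `S⁴`).

On top of this, `RicciFlowThroughSingularitiesFour M g₀` is the STRUCTURE "a metric flow `𝒳`
over `[0, ∞)` together with an isometry of its initial time-slice `(𝒳_0, d_0)` with `(M, d_{g₀})`"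
(the data shared by every candidate notion: Notices Thm. 4.6 "singular Ricci flow whose initial
time-slice is `(M, g)`"; Bamler 2023 §3.7: slices carry the length metrics). Existence and
uniqueness from `(M, g₀)` are OPEN (Conj. 5.8) and nothing here asserts them; every regularity
property — `H₄`-concentration, structure of the singular part, the nature of tangent flows at
singular points (Notices Thm. 5.4 for limits of smooth flows), absence of orbifold points,
finiteness of the singular times — is a HYPOTHESIS that users (first: the cruxes
`TameTranscriptMetric` / `TameTranscriptTwoHandlebody` of route `SmoothPoincare4/RicciTranscript`,
whose "tame transcript" predicate is theirs to state) formulate with the vocabulary above.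

## Design notes

* Everything is a definition with a body; the only named facts in the import cone are those of
  `RicciFlow.lean` / `RiemannianDistance.lean` / `Volume.lean` already in the tree. No new
  `def … : Prop` fact is introduced.
* Points of a metric flow are the Σ-type `MetricFlow.Pt` of `MetricFlow.lean`; times are
  elements of the index set `I : Set ℝ`; kernels at later times are junk values never used
  (as in `MetricFlow.lean`).
* `FDistWithin`/`FDist` take the raw data (two flows over arbitrary index sets with measure
  families, the set `I''` of compared times and `J`), so that the rescalings in the definition of
  tangent flows need not be repackaged as metric flow pairs; `FlowPair` records Bamler's side
  conditions (`|I ∖ I'| = 0`, conjugate heat flow of full support) for the space `𝔽_I^J`.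
  Comparison spaces `Z_t` of a correspondence range over metric spaces in the universe of the
  slices (no loss for separable slices) and are indexed by all `t : ℝ`.
* `RegularChart` fixes the model of the chart manifold to `ℝⁿ` (`𝓡 n`, any `n`, boundaryless,
  `C^∞`), carries the Levi-Civita connections as explicit witnesses (as `IsRicciFlow` does) and
  takes time derivatives within the subinterval (`HasDerivWithinAt`), as `RicciFlow.lean`.
* One file rather than three: each layer imports the previous one and the 4-dimensional
  structure at the end is the requested notion (`defn-RicciFlowThroughSingularitiesFour`).

## What is NOT here

* Kleiner–Lott Ricci flow spacetimes `(𝓜, 𝔱, ∂_𝔱, g)` as a stand-alone structure (Kleiner–Lott,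
  *Singular Ricci flows I*, Acta Math. 219 (2017), Def. 1.2 = Bamler 2023, §9.1, Definition; a
  metric on the subbundle `ker d𝔱` has no carrier in Mathlib) — the regular part `ℛ` is where it
  would live (§9.2, Theorem: `ℛ` carries a unique such structure); 0-completeness and canonical
  neighbourhood assumptions of the 3-dimensional theory (Notices Defs. 4.8–4.10).
* The metric flow OF a smooth (super) Ricci flow (§3.7, Theorem: needs the heat kernel of a
  Ricci flow background), hence no inhabitant of `RicciFlowThroughSingularitiesFour M g₀` is
  constructed even for short time; `IsModelledOn` is the kernel-free substitute.
* `𝔽`-convergence within a correspondence, convergence of points and of conjugate heat flows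
  (§6.1–6.4), the compactness theorems (§7), future completion (§4.4), `H`-centres, the
  `*`-Hausdorff measures of §3.3, metric solitons and the Nash entropy (Bamler 2020c).
* Model flows other than the round sphere: the shrinking cylinders `S³ × ℝ`, `S² × ℝ²` need
  product Riemannian metrics, absent from the tree (`shrinkingSphereFourMetric` of
  `ShrinkingRoundSphereFour.lean` gives the `S⁴` model).
-- TODO(general form): correspondences between families of flows indexed by `ℕ ∪ {∞}` and
-- `𝔽`-convergence within a correspondence (§6.1).

## References

* R. H. Bamler, *Compactness theory of the space of super Ricci flows*, Invent. Math. 233 (2023)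
  1121–1277 (arXiv:2008.09298): §2.1 (`d_{W_p}`), §2.2 Def. (Variance), §3.1 Def. 3.2 (metric
  flow), Def. (Isometry between metric flows), Lemma (parabolic rescaling), §3.4 Def.
  (`H`-Concentration), §3.5 Defs. (`P*`-parabolic neighborhood / ball), §3.6 Def. (natural
  topology), §3.7 Theorems (super Ricci flows and 3d singular Ricci flows as `H_n`-concentrated
  metric flows), §5.1 Defs. (Metric flow pairs), (Correspondence), (`𝔽`-distance within
  correspondence), (`𝔽`-distance), §5.2 Theorem, §6.8 Def. (Tangent flow), §9.1 Def. (Ricci flow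
  spacetime), §9.2 Def. (Regular points), Theorem and Def. (Regular part). [Bamler2023]
* R. H. Bamler, *Recent developments in Ricci flows*, Notices AMS 68 (2021) no. 9
  (arXiv:2102.12615): §4.5 Thm. 4.6, Defs. 4.7–4.10; §5.2–5.6, Conj. 5.2, Thms. 5.3–5.5,
  Def. 5.7, Conj. 5.8. [Bamler2021Notices]
* R. H. Bamler, *Structure theory of non-collapsed limits of Ricci flows*, arXiv:2009.03243
  (2020): tangent flows are metric solitons; orbifold structure in dimension 4. [Bamler2020Structure]
* B. Kleiner, J. Lott, *Singular Ricci flows I*, Acta Math. 219 (2017) 65–134 (arXiv:1408.2271),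
  Def. 1.2 (Ricci flow spacetime). [KleinerLott2017]
-/

noncomputable section

open Set MeasureTheory Filter Function
open scoped Topology ENNReal NNReal Manifold ContDiff

namespace Literature.Geometry.Riemannian

universe u v

/-! ### Scaled copies of a metric space (for parabolic rescaling) -/

/-- **Type synonym: the metric space `X` with all distances multiplied by the constant `c > 0`**
(`dist' x y = c · dist x y`). Used for the parabolic rescaling of a metric flow (Bamler 2023,
§3.1, Lemma (parabolic rescaling); §6.8), whose time-`λ²(t − ΔT)` slice is `(𝒳_t, λ d_t)`. The
uniform structure, topology, bornology-free data, σ-algebra and completeness/separability are those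
of `X` (a positive rescaling changes none of them). [folklore] -/
@[nolint unusedArguments]
def ScaledDist (_c : ℝ) (X : Type u) : Type u := X

namespace ScaledDist

variable {c : ℝ} {X : Type u}

/-- The identity map `X → ScaledDist c X`. [folklore] -/
def toScaled : X ≃ ScaledDist c X := Equiv.refl X

/-- The identity map `ScaledDist c X → X`. [folklore] -/
def ofScaled : ScaledDist c X ≃ X := Equiv.refl X

/-- `ofScaled ∘ toScaled = id`. [folklore] -/
@[simp] theorem ofScaled_toScaled (x : X) : ofScaled (toScaled (c := c) x) = x := rfl

/-- `toScaled ∘ ofScaled = id`. [folklore] -/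
@[simp] theorem toScaled_ofScaled (x : ScaledDist c X) : toScaled (ofScaled x) = x := rfl

/-- The σ-algebra of `X`. [folklore] -/
instance [MeasurableSpace X] : MeasurableSpace (ScaledDist c X) := ‹MeasurableSpace X›

section Metric

variable [Fact (0 < c)]

/-- The scaled distance `c · d` (as a pseudo-metric structure with the SAME uniformity as `X`).
[folklore] -/
instance instPseudoMetricSpace [m : PseudoMetricSpace X] : PseudoMetricSpace (ScaledDist c X) where
  dist x y := c * dist (ofScaled x) (ofScaled y)
  dist_self x := by simp
  dist_comm x y := by rw [dist_comm]
  dist_triangle x y z := by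
    have hc : 0 < c := Fact.out
    have h := dist_triangle (ofScaled x) (ofScaled y) (ofScaled z)
    nlinarith
  toUniformSpace := m.toUniformSpace
  uniformity_dist := by
    have hc : 0 < c := Fact.out
    show @uniformity X m.toUniformSpace = ⨅ ε > 0, 𝓟 {p : X × X | c * dist p.1 p.2 < ε}
    rw [PseudoMetricSpace.uniformity_dist (α := X)]
    apply le_antisymm
    · refine le_iInf₂ fun ε hε ↦ ?_
      refine (iInf₂_le (ε / c) (div_pos hε hc)).trans ?_
      refine principal_mono.2 fun p hp ↦ ?_
      simp only [mem_setOf_eq] at hp ⊢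
      rwa [lt_div_iff₀ hc, mul_comm] at hp
    · refine le_iInf₂ fun ε hε ↦ ?_
      refine (iInf₂_le (c * ε) (mul_pos hc hε)).trans ?_
      refine principal_mono.2 fun p hp ↦ ?_
      simp only [mem_setOf_eq] at hp ⊢
      change c * dist _ _ < c * ε at hp
      exact lt_of_mul_lt_mul_left hp hc.le
  toBornology := Bornology.ofDist (fun x y ↦ c * dist (ofScaled x) (ofScaled y))
    (fun x y ↦ by rw [dist_comm]) (fun x y z ↦ by
      have hc : 0 < c := Fact.out
      have h := dist_triangle (ofScaled x) (ofScaled y) (ofScaled z)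
      nlinarith)

omit [Fact (0 < c)] in
/-- The scaled distance unfolds to `c · d`. [folklore] -/
theorem dist_eq [PseudoMetricSpace X] [Fact (0 < c)] (x y : ScaledDist c X) :
    dist x y = c * dist (ofScaled x) (ofScaled y) := rfl

/-- The scaled extended distance is `c · edist`. [folklore] -/
theorem edist_eq [PseudoMetricSpace X] (x y : ScaledDist c X) :
    edist x y = ENNReal.ofReal c * edist (ofScaled x) (ofScaled y) := by
  have hc : 0 < c := Fact.out
  rw [edist_dist, edist_dist, dist_eq, ENNReal.ofReal_mul hc.le]

/-- The scaled distance of a metric space is a metric space. [folklore] -/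
instance instMetricSpace [m : MetricSpace X] : MetricSpace (ScaledDist c X) where
  eq_of_dist_eq_zero {x y} h := by
    have hc : 0 < c := Fact.out
    rw [dist_eq, mul_eq_zero] at h
    exact m.eq_of_dist_eq_zero (h.resolve_left hc.ne')

/-- Completeness is that of `X` (same uniformity). [folklore] -/
instance [PseudoMetricSpace X] [CompleteSpace X] : CompleteSpace (ScaledDist c X) :=
  ‹CompleteSpace X›

/-- Separability is that of `X` (same topology). [folklore] -/
instance [PseudoMetricSpace X] [TopologicalSpace.SeparableSpace X] :
    TopologicalSpace.SeparableSpace (ScaledDist c X) :=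
  ‹TopologicalSpace.SeparableSpace X›

/-- The σ-algebra is still the Borel σ-algebra (same topology). [folklore] -/
instance [PseudoMetricSpace X] [MeasurableSpace X] [BorelSpace X] : BorelSpace (ScaledDist c X) :=
  ‹BorelSpace X›

/-- A map out of the scaled space is `K`-Lipschitz iff, read on `X`, it is `c · K`-Lipschitz.
[folklore] -/
theorem lipschitzWith_iff [PseudoMetricSpace X] {Y : Type*} [PseudoEMetricSpace Y] {K : ℝ≥0}
    {f : ScaledDist c X → Y} :
    LipschitzWith K f ↔ LipschitzWith (Real.toNNReal c * K) (f ∘ toScaled) := by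
  have key : ∀ x y : X, ((Real.toNNReal c * K : ℝ≥0) : ℝ≥0∞) * edist x y =
      K * edist (toScaled (c := c) x) (toScaled y) := by
    intro x y
    rw [edist_eq]
    simp only [ofScaled_toScaled, ENNReal.ofReal, ENNReal.coe_mul]
    ring
  constructor
  · intro h x y
    rw [comp_apply, comp_apply, key]
    exact h _ _
  · intro h x y
    have h' := h (ofScaled x) (ofScaled y)
    rw [comp_apply, comp_apply, key, toScaled_ofScaled, toScaled_ofScaled] at h'
    exact h'

end Metric

end ScaledDist

namespace MetricFlow

variable {I : Set ℝ}

/-! ### §3.1: flow isometries (Bamler 2023, Def. (Isometry between metric flows)) -/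

/-- **Flow isometry** between two metric flows over the same `I` (Bamler 2023, §3.1,
Def. (Isometry between metric flows): "a map `φ : 𝒳¹ → 𝒳²` given by a family of maps
`(φ_t : 𝒳¹_t → 𝒳²_t)_{t ∈ I}` is called a flow isometry over `I` if (1) `φ_t : (𝒳¹_t, d¹_t) →
(𝒳²_t, d²_t)` is a metric isometry for all `t ∈ I`; (2) `(φ_s)_* ν¹_{x;s} = ν²_{φ(x);s}` for all
`x ∈ 𝒳¹`, `s ∈ I`, `s ≤ 𝔱(x)`"): slice-wise isometries of metric spaces intertwining the conjugate
heat kernels. Flow isometries over `I' ⊆ I¹ ∩ I²`, almost-everywhere flow isometries and flow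
isometric embeddings (same Definition) are flow isometries between restrictions
(`MetricFlow.restrict`), see `IsFlowIsometricOver`, `IsAEFlowIsometric`. [cite: Bamler2023, §3.1, Definition (Isometry between metric flows)] -/
structure FlowIsometry (𝒳₁ : MetricFlow.{u} I) (𝒳₂ : MetricFlow.{v} I) where
  /-- The slice maps `φ_t`, isometries of metric spaces. -/
  toIsometryEquiv : ∀ t : I, 𝒳₁.Slice t ≃ᵢ 𝒳₂.Slice t
  /-- `(φ_s)_* ν¹_{x;s} = ν²_{φ_t(x);s}` for `s ≤ t`. -/
  map_condKernel : ∀ {t : I} (x : 𝒳₁.Slice t) {s : I}, (s : ℝ) ≤ t →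
    (𝒳₁.condKernel x s).map (toIsometryEquiv s) = 𝒳₂.condKernel (toIsometryEquiv t x) s

/-- The identity is a flow isometry. [cite: Bamler2023, §3.1, Definition (Isometry between metric flows)] -/
def FlowIsometry.refl (𝒳 : MetricFlow.{u} I) : FlowIsometry 𝒳 𝒳 where
  toIsometryEquiv t := IsometryEquiv.refl _
  map_condKernel x s _ := by
    change (𝒳.condKernel x s).map id = _
    rw [Measure.map_id]
    rfl

/-- The inverse of a flow isometry is a flow isometry. [cite: Bamler2023, §3.1, Definition (Isometry between metric flows)] -/
def FlowIsometry.symm {𝒳₁ : MetricFlow.{u} I} {𝒳₂ : MetricFlow.{v} I} (φ : FlowIsometry 𝒳₁ 𝒳₂) :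
    FlowIsometry 𝒳₂ 𝒳₁ where
  toIsometryEquiv t := (φ.toIsometryEquiv t).symm
  map_condKernel {t} y {s} hst := by
    have h := φ.map_condKernel ((φ.toIsometryEquiv t).symm y) hst
    rw [IsometryEquiv.apply_symm_apply] at h
    rw [← h, Measure.map_map (φ.toIsometryEquiv s).symm.continuous.measurable
      (φ.toIsometryEquiv s).continuous.measurable]
    change (𝒳₁.condKernel _ s).map ((φ.toIsometryEquiv s).symm ∘ (φ.toIsometryEquiv s)) = _
    rw [IsometryEquiv.symm_comp_self, Measure.map_id]

/-- **`𝒳¹` and `𝒳²` are flow isometric over `I' ⊆ I¹ ∩ I²`** (Bamler 2023, §3.1, same Definition: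
"a flow isometry `φ : 𝒳¹_{I'} → 𝒳²_{I'}` is called a flow isometry between `𝒳¹, 𝒳²` over `I'`").
[cite: Bamler2023, §3.1, Definition (Isometry between metric flows)] -/
def IsFlowIsometricOver {I₁ I₂ : Set ℝ} (I' : Set ℝ) (𝒳₁ : MetricFlow.{u} I₁)
    (𝒳₂ : MetricFlow.{v} I₂) (h₁ : I' ⊆ I₁) (h₂ : I' ⊆ I₂) : Prop :=
  Nonempty (FlowIsometry (𝒳₁.restrict h₁) (𝒳₂.restrict h₂))

/-- **Almost everywhere flow isometric** metric flows (Bamler 2023, §3.1, same Definition: "if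
`I¹ ∖ I'` and `I² ∖ I'` are sets of measure zero, then a flow isometry between `𝒳¹, 𝒳²` over `I'` is
called an almost everywhere flow isometry"). [cite: Bamler2023, §3.1, Definition (Isometry between metric flows)] -/
def IsAEFlowIsometric {I₁ I₂ : Set ℝ} (𝒳₁ : MetricFlow.{u} I₁) (𝒳₂ : MetricFlow.{v} I₂) : Prop :=
  ∃ (I' : Set ℝ) (h₁ : I' ⊆ I₁) (h₂ : I' ⊆ I₂),
    volume (I₁ \ I') = 0 ∧ volume (I₂ \ I') = 0 ∧ IsFlowIsometricOver I' 𝒳₁ 𝒳₂ h₁ h₂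

/-! ### §3.4, §3.7: `H`-concentration constants (over `MetricFlowConcentration.lean`) -/

/-- The one-point metric flow `MetricFlow.point I` is `H`-concentrated
(`MetricFlow.IsHConcentrated`, `MetricFlowConcentration.lean`) for every `H` (all the variances
`Var(δ, δ) = 0` vanish; non-vacuity of the definition). [folklore] -/
theorem isHConcentrated_point (I : Set ℝ) (H : ℝ) : (point I).IsHConcentrated H := by
  intro s t hst x₁ x₂
  have h0 : variance ((point I).condKernel x₁ s) ((point I).condKernel x₂ s) = 0 := by
    change variance (Measure.dirac PUnit.unit) (Measure.dirac PUnit.unit) = 0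
    rw [variance_dirac_dirac, edist_self]
    simp
  rw [h0]
  exact zero_le

/-- **Bamler's dimensional constant `H_n := (n − 1)π²/2 + 4`** (Bamler 2023, §3.7, Theorem (metric
flow of a super Ricci flow): the metric flow of an `n`-dimensional super Ricci flow on a compact
manifold "is an `H_n := ((n−1)π²/2 + 4)`-concentrated metric flow"; singular Ricci flows in
dimension 3 are `H₃`-concentrated, Theorem following it). [cite: Bamler2023, §3.7, Theorem (super Ricci flows as metric flows)] -/
def concentrationConst (n : ℕ) : ℝ :=
  ((n : ℝ) - 1) * Real.pi ^ 2 / 2 + 4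

/-- `H₄ = 3π²/2 + 4`. [cite: Bamler2023, §3.7, Theorem (super Ricci flows as metric flows)] -/
theorem concentrationConst_four : concentrationConst 4 = 3 * Real.pi ^ 2 / 2 + 4 := by
  norm_num [concentrationConst]

/-! ### §3.1, §6.8: time shift and parabolic rescaling `𝒳^{−ΔT, λ}` -/

section Rescale

variable (𝒳 : MetricFlow.{u} I) (ΔT : ℝ) (la : ℝ) (hla : 0 < la)

/-- The index set of the time-shifted and parabolically rescaled flow: `λ²(I − ΔT)`.
[cite: Bamler2023, §6.8 (the flows `𝒳^{−ΔT,λ}`)] -/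
def rescaleTimes (I : Set ℝ) (ΔT la : ℝ) : Set ℝ :=
  (fun t : ℝ ↦ la ^ 2 * (t - ΔT)) '' I

variable {𝒳 ΔT la}

/-- The original time `ΔT + t'/λ²` of a rescaled time `t'` lies in `I`. [cite: Bamler2023, §6.8 (the flows `𝒳^{−ΔT,λ}`)] -/
theorem mem_of_mem_rescaleTimes (hla : 0 < la) {t' : ℝ} (ht' : t' ∈ rescaleTimes I ΔT la) :
    ΔT + t' / la ^ 2 ∈ I := by
  obtain ⟨t, ht, rfl⟩ := ht'
  have : la ^ 2 ≠ 0 := by positivity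
  convert ht using 1
  field_simp
  ring

/-- The original time `ΔT + t'/λ²` of a rescaled time `t'`, as an element of `I` ("any point
`x ∈ 𝒳_t` corresponds to a point in `𝒳^{−ΔT,λ}_{λ²(t−ΔT)}`"). [cite: Bamler2023, §6.8 (the flows `𝒳^{−ΔT,λ}`)] -/
def origTime (hla : 0 < la) (t' : rescaleTimes I ΔT la) : I :=
  ⟨ΔT + (t' : ℝ) / la ^ 2, mem_of_mem_rescaleTimes hla t'.2⟩

/-- Unfolding `origTime`. [folklore] -/
@[simp] theorem coe_origTime (hla : 0 < la) (t' : rescaleTimes I ΔT la) :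
    (origTime (I := I) (ΔT := ΔT) hla t' : ℝ) = ΔT + (t' : ℝ) / la ^ 2 := rfl

/-- `origTime` is monotone (`λ² > 0`). [folklore] -/
theorem origTime_le_iff (hla : 0 < la) {s' t' : rescaleTimes I ΔT la} :
    (origTime (I := I) (ΔT := ΔT) hla s' : ℝ) ≤ origTime hla t' ↔ (s' : ℝ) ≤ t' := by
  simp only [coe_origTime, add_le_add_iff_left]
  exact div_le_div_iff_of_pos_right (by positivity)

/-- `origTime` is strictly monotone (`λ² > 0`). [folklore] -/
theorem origTime_lt_iff (hla : 0 < la) {s' t' : rescaleTimes I ΔT la} :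
    (origTime (I := I) (ΔT := ΔT) hla s' : ℝ) < origTime hla t' ↔ (s' : ℝ) < t' := by
  simp only [coe_origTime, add_lt_add_iff_left]
  exact div_lt_div_iff_of_pos_right (by positivity)

variable (𝒳 ΔT la)

/-- **Time shift by `−ΔT` followed by parabolic rescaling by `λ > 0`**: the metric flow
`𝒳^{−ΔT,λ}` over `λ²(I − ΔT)` whose time-`λ²(t − ΔT)` slice is `(𝒳_t, λ d_t)` with the same
conjugate heat kernels (Bamler 2023, §3.1, Lemma (invariance of the definition under parabolic
rescaling by `λ > 0` and time-shift by `t₀`); §6.8: "we will denote by `𝒳^{−ΔT,λ}` the result of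
applying a time-shift of `−ΔT` to `𝒳` and then a parabolic rescaling by `λ`. So any point `x ∈ 𝒳_t`
corresponds to a point in `𝒳^{−ΔT,λ}_{λ²(t−ΔT)}`"). The proof obligations are those of the printed
Lemma: items (1)–(5), (7) are index bookkeeping; in the gradient property (6) a `T^{-1/2}`-Lipschitz
function for `λ d` is `λ T^{-1/2} = (T/λ²)^{-1/2}`-Lipschitz for `d`, and `t − s + T/λ²` at the
original times is `(t' − s' + T)/λ²` at the rescaled ones. [cite: Bamler2023, §3.1, Lemma (parabolic rescaling and time-shift)] -/
def rescale : MetricFlow.{u} (rescaleTimes I ΔT la) :=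
  haveI : Fact (0 < la) := ⟨hla⟩
  { Slice := fun t' ↦ ScaledDist la (𝒳.Slice (origTime hla t'))
    condKernel := fun {t'} x s' ↦
      (𝒳.condKernel (ScaledDist.ofScaled x) (origTime hla s') :
        Measure (𝒳.Slice (origTime hla s')))
    isProbabilityMeasure_condKernel := fun {t'} x {s'} hst ↦
      𝒳.isProbabilityMeasure_condKernel (ScaledDist.ofScaled x) ((origTime_le_iff hla).2 hst)
    condKernel_self := fun {t'} x ↦ 𝒳.condKernel_self (ScaledDist.ofScaled x)
    gradient_property := by
      intro s' t' hst T hT u hu h01 hLip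
      have hst₀ : (origTime (I := I) (ΔT := ΔT) hla s' : ℝ) < origTime hla t' :=
        (origTime_lt_iff hla).2 hst
      have hla2 : 0 < la ^ 2 := by positivity
      -- the hypothesis, read on the original slice with `T/λ²`
      have hLip₀ : 0 < T / la ^ 2 → ∃ f : 𝒳.Slice (origTime hla s') → ℝ,
          LipschitzWith (Real.toNNReal (1 / Real.sqrt (T / la ^ 2))) f ∧
            (u ∘ ScaledDist.toScaled) = MetricFlow.Phi ∘ f := by
        intro hT'
        have hT0 : 0 < T := (div_pos_iff_of_pos_right hla2).1 hT'
        obtain ⟨f, hf, huf⟩ := hLip hT0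
        refine ⟨f ∘ ScaledDist.toScaled, ?_, by rw [huf]; rfl⟩
        have hf' := (ScaledDist.lipschitzWith_iff (c := la)).1 hf
        have hc : Real.toNNReal la * Real.toNNReal (1 / Real.sqrt T) =
            Real.toNNReal (1 / Real.sqrt (T / la ^ 2)) := by
          rw [← Real.toNNReal_mul hla.le]
          congr 1
          rw [Real.sqrt_div' _ hla2.le, Real.sqrt_sq hla.le]
          field_simp
        rw [hc] at hf'
        exact hf'
      rcases 𝒳.gradient_property hst₀ (T / la ^ 2) (div_nonneg hT hla2.le) (u ∘ ScaledDist.toScaled)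
        hu h01 hLip₀ with ⟨c, hc⟩ | ⟨f', hf', huf'⟩
      · exact Or.inl ⟨c, fun x ↦ hc (ScaledDist.ofScaled x)⟩
      · refine Or.inr ⟨f' ∘ ScaledDist.ofScaled, ?_, fun x ↦ huf' (ScaledDist.ofScaled x)⟩
        rw [ScaledDist.lipschitzWith_iff (c := la)]
        have hc : Real.toNNReal la * Real.toNNReal (1 / Real.sqrt ((t' : ℝ) - s' + T)) =
            Real.toNNReal (1 / Real.sqrt ((origTime (I := I) (ΔT := ΔT) hla t' : ℝ)
              - origTime hla s' + T / la ^ 2)) := by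
          rw [← Real.toNNReal_mul hla.le]
          congr 1
          rw [coe_origTime, coe_origTime,
            show ΔT + (t' : ℝ) / la ^ 2 - (ΔT + (s' : ℝ) / la ^ 2) + T / la ^ 2
              = ((t' : ℝ) - s' + T) / la ^ 2 by field_simp; ring,
            Real.sqrt_div' _ hla2.le, Real.sqrt_sq hla.le]
          field_simp
        rw [hc]
        exact hf'
    reproduction := fun {t₁ t₂ t₃} h12 h23 x S hS ↦
      𝒳.reproduction ((origTime_le_iff hla).2 h12) ((origTime_le_iff hla).2 h23)
        (ScaledDist.ofScaled x) S hS }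

/-- The slices of `𝒳^{−ΔT,λ}` are the rescaled original slices. [cite: Bamler2023, §3.1, Lemma (parabolic rescaling and time-shift)] -/
theorem rescale_Slice (t' : rescaleTimes I ΔT la) :
    (𝒳.rescale ΔT la hla).Slice t' = ScaledDist la (𝒳.Slice (origTime hla t')) := rfl

/-- Distances in `𝒳^{−ΔT,λ}_{t'}` are `λ` times the original ones. [cite: Bamler2023, §3.1, Lemma (parabolic rescaling and time-shift)] -/
theorem rescale_dist (t' : rescaleTimes I ΔT la) (x y : (𝒳.rescale ΔT la hla).Slice t') :
    dist x y = la * dist (ScaledDist.ofScaled (c := la) x : 𝒳.Slice (origTime hla t'))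
      (ScaledDist.ofScaled (c := la) y) := rfl

/-- The conjugate heat kernels of `𝒳^{−ΔT,λ}` are the original ones (reindexed). [cite: Bamler2023, §3.1, Lemma (parabolic rescaling and time-shift)] -/
theorem rescale_condKernel {t' : rescaleTimes I ΔT la} (x : (𝒳.rescale ΔT la hla).Slice t')
    (s' : rescaleTimes I ΔT la) :
    (𝒳.rescale ΔT la hla).condKernel x s' =
      (𝒳.condKernel (ScaledDist.ofScaled (c := la) x : 𝒳.Slice (origTime hla t'))
        (origTime hla s') : Measure (𝒳.Slice (origTime hla s'))) := rfl

end Rescale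

/-! ### §3.5–3.6: `P*`-parabolic neighbourhoods and the natural topology -/

section NaturalTopology

variable (𝒳 : MetricFlow.{u} I)

/-- **`P*`-parabolic neighbourhood** `P*(x; A, −T⁻, T⁺)` of a point `x ∈ 𝒳` (Bamler 2023, §3.5,
Def. (`P*`-parabolic neighborhood): for `A, T⁻, T⁺ ≥ 0` with `𝔱(x) − T⁻ ∈ I`, "the set of points
`x' ∈ 𝒳` with the property that `𝔱(x') ∈ [𝔱(x) − T⁻, 𝔱(x) + T⁺]`,
`d_{W₁}^{𝒳_{𝔱(x)−T⁻}}(ν_{x;𝔱(x)−T⁻}, ν_{x';𝔱(x)−T⁻}) < A`"); points of `𝒳` are the elements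
of the Σ-type `𝒳.Pt`. [cite: Bamler2023, §3.5, Definition (P*-parabolic neighborhood)] -/
def pParabolicNhd (x : 𝒳.Pt) (A Tm Tp : ℝ) (h : (x.1 : ℝ) - Tm ∈ I) : Set 𝒳.Pt :=
  {x' | (x'.1 : ℝ) ∈ Icc ((x.1 : ℝ) - Tm) (x.1 + Tp) ∧
    wassersteinW1 (𝒳.condKernel x.2 ⟨(x.1 : ℝ) - Tm, h⟩) (𝒳.condKernel x'.2 ⟨(x.1 : ℝ) - Tm, h⟩)
      < ENNReal.ofReal A}

/-- **`P*`-parabolic ball** `P*(x; r) := P*(x; r, −r², r²)`, defined when `𝔱(x) − r² ∈ I`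
(Bamler 2023, §3.5, Def. (`P*`-parabolic ball)). [cite: Bamler2023, §3.5, Definition (P*-parabolic ball)] -/
def pParabolicBall (x : 𝒳.Pt) (r : ℝ) (h : (x.1 : ℝ) - r ^ 2 ∈ I) : Set 𝒳.Pt :=
  𝒳.pParabolicNhd x r (r ^ 2) (r ^ 2) h

/-- `x ∈ P*(x; r)` for `r > 0` (`d_{W₁}(ν, ν) = 0 < r`, `𝔱(x) ∈ [𝔱(x) − r², 𝔱(x) + r²]`; cf.
Bamler 2023, §3.6, Proposition, (d): "the `P*`-parabolic neighborhoods `P*(x, r)` are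
neighborhoods of `x` if they exist"). [cite: Bamler2023, §3.6, Proposition (properties of the natural topology), (d)] -/
theorem mem_pParabolicBall_self (x : 𝒳.Pt) {r : ℝ} (hr : 0 < r) (h : (x.1 : ℝ) - r ^ 2 ∈ I) :
    x ∈ 𝒳.pParabolicBall x r h := by
  refine ⟨⟨by nlinarith, by nlinarith⟩, ?_⟩
  have hs : ((⟨(x.1 : ℝ) - r ^ 2, h⟩ : I) : ℝ) ≤ x.1 := show (x.1 : ℝ) - r ^ 2 ≤ x.1 by nlinarith
  -- the diagonal coupling `(id, id)_* ν` of `ν := ν_{x; 𝔱(x) - r²}` with itself has cost `0`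
  have hq : ∀ ν : Measure (𝒳.Slice ⟨(x.1 : ℝ) - r ^ 2, h⟩), IsProbabilityMeasure ν →
      IsCoupling ν ν (ν.map fun z ↦ (z, z)) :=
    fun ν hν ↦
    ⟨Measure.isProbabilityMeasure_map (measurable_id'.prodMk measurable_id').aemeasurable,
     (Measure.map_map measurable_fst (measurable_id'.prodMk measurable_id')).trans Measure.map_id,
     (Measure.map_map measurable_snd (measurable_id'.prodMk measurable_id')).trans Measure.map_id⟩
  refine lt_of_le_of_lt (wassersteinW1_le_lintegral (hq _ (𝒳.isProbabilityMeasure hs x.2))) ?_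
  refine lt_of_le_of_lt (lintegral_map_le _ _) ?_
  simp [ENNReal.ofReal_pos.2 hr]

/-- **Covering number by `P*`-parabolic balls of radius `r`** (Bamler 2023, §3.3, Def. (Minkowski
dimension): "`N_covering(S, r) := min {N ≥ 0 : there are x₁, …, x_N ∈ 𝒳 with
S ⊂ ⋃_i P*(x_i, r)}`"), in `ℕ∞` (`∞` if no finite cover exists; only balls `P*(x_i, r)` that are
defined, i.e. with `𝔱(x_i) − r² ∈ I`, are used). [cite: Bamler2023, §3.3, Definition (Minkowski dimension)] -/
def coveringNumber (S : Set 𝒳.Pt) (r : ℝ) : ℕ∞ :=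
  ⨅ (N : ℕ) (_ : ∃ (x : Fin N → 𝒳.Pt) (h : ∀ i, ((x i).1 : ℝ) - r ^ 2 ∈ I),
    S ⊆ ⋃ i, 𝒳.pParabolicBall (x i) r (h i)), (N : ℕ∞)

/-- **The `*`-Minkowski dimension** of a subset of a metric flow (Bamler 2023, §3.3,
Def. (Minkowski dimension): "`dim_{𝓜*} S := sup_{x₀, A, T^±} limsup_{r → 0}
log N_covering(S ∩ P*(x₀; A, T⁻, T⁺), r) / log(1/r)`, where the first supremum is taken over all
`x₀, A, T^±` with the property that `P*(x₀; A, T⁻, T⁺) ⊂ 𝒳` is defined" — `A, T^± ≥ 0`,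
`𝔱(x₀) − T⁻ ∈ I`), valued in `EReal` (`log` of the covering number as `ENNReal.log`, the
`limsup` along `r → 0⁺`). This is the dimension in the estimate `dim_{𝓜*} 𝒮 ≤ (n + 2) − 4` of the
singular part of a non-collapsed limit (Bamler 2021, Thm. 5.4). [cite: Bamler2023, §3.3, Definition (Minkowski dimension)] -/
def minkowskiDimStar (S : Set 𝒳.Pt) : EReal :=
  ⨆ (x₀ : 𝒳.Pt) (A : ℝ) (_ : 0 ≤ A) (Tm : ℝ) (_ : 0 ≤ Tm) (Tp : ℝ) (_ : 0 ≤ Tp)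
    (h : (x₀.1 : ℝ) - Tm ∈ I),
    Filter.limsup (fun r : ℝ ↦
      ENNReal.log (𝒳.coveringNumber (S ∩ 𝒳.pParabolicNhd x₀ A Tm Tp h) r : ℝ≥0∞) /
        (Real.log (1 / r) : EReal)) (𝓝[>] 0)

/-- **The natural topology** on (the points `𝒳.Pt` of) a metric flow (Bamler 2023, §3.6,
Def. (natural topology): "A subset `U ⊂ 𝒳` is called open if for any `x ∈ U` there is an `r > 0`
such that for all `r' ∈ (0, r]` the following is true: If `P*(x, r')` exists, then
`P*(x, r') ⊂ U`"). It is a topology (Prop. following the Definition; in general neither Hausdorff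
nor making `𝒳_t → 𝒳` open, Remark there). Not registered as an instance.
[cite: Bamler2023, §3.6, Definition (natural topology)] -/
@[reducible]
def naturalTopology : TopologicalSpace 𝒳.Pt where
  IsOpen U := ∀ x ∈ U, ∃ r : ℝ, 0 < r ∧ ∀ r' : ℝ, 0 < r' → r' ≤ r →
    ∀ h : (x.1 : ℝ) - r' ^ 2 ∈ I, 𝒳.pParabolicBall x r' h ⊆ U
  isOpen_univ x _ := ⟨1, one_pos, fun _ _ _ _ ↦ subset_univ _⟩
  isOpen_inter U V hU hV x hx := by
    obtain ⟨r₁, hr₁, h₁⟩ := hU x hx.1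
    obtain ⟨r₂, hr₂, h₂⟩ := hV x hx.2
    exact ⟨min r₁ r₂, lt_min hr₁ hr₂, fun r' hr' hle h ↦ subset_inter
      (h₁ r' hr' (hle.trans (min_le_left _ _)) h) (h₂ r' hr' (hle.trans (min_le_right _ _)) h)⟩
  isOpen_sUnion S hS x hx := by
    obtain ⟨U, hU, hxU⟩ := mem_sUnion.1 hx
    obtain ⟨r, hr, h⟩ := hS U hU x hxU
    exact ⟨r, hr, fun r' hr' hle h' ↦ (h r' hr' hle h').trans (subset_sUnion_of_mem hU)⟩

end NaturalTopology

/-! ### §5.1: metric flow pairs, correspondences and the `𝔽`-distance -/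

section FDistance

/-- **Metric flow pair over `I`** (Bamler 2023, §5.1, Def. (Metric flow pairs and isometries): "A
pair `(𝒳, (μ_t)_{t ∈ I'})` is called a metric flow pair over `I ⊂ ℝ` if: (1) `I' ⊂ I` with
`|I ∖ I'| = 0`. (2) `𝒳` is a metric flow over `I'`. (3) `(μ_t)_{t ∈ I'}` is a conjugate heat flow on
`𝒳` with `supp μ_t = 𝒳_t` for all `t ∈ I'`"; full support is stated as: every ball of positive
radius has positive `μ_t`-measure, the characterisation of `supp` in §2.1, Lemma (basic measure
theory) (c)). "Fully defined over `J`" means `J ⊆ I'` (`FlowPair.FullyDefinedOver`).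
[cite: Bamler2023, §5.1, Definition (Metric flow pairs and isometries)] -/
structure FlowPair (I : Set ℝ) : Type (u + 1) where
  /-- The set of times `I' ⊆ I` over which the flow is defined … -/
  times : Set ℝ
  /-- … a subset of `I` … -/
  times_subset : times ⊆ I
  /-- … of full measure: `|I ∖ I'| = 0`. -/
  volume_diff : volume (I \ times) = 0
  /-- The metric flow `𝒳` over `I'`. -/
  flow : MetricFlow.{u} times
  /-- The conjugate heat flow `(μ_t)_{t ∈ I'}` … -/
  μ : ∀ t : times, Measure (flow.Slice t)
  /-- … is a conjugate heat flow over all of `I'` … -/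
  isConjugateHeatFlow : flow.IsConjugateHeatFlow univ μ
  /-- … with `supp μ_t = 𝒳_t`: every open ball has positive measure. -/
  full_support : ∀ (t : times) (x : flow.Slice t) (r : ℝ), 0 < r → 0 < μ t (Metric.ball x r)

namespace FlowPair

/-- A metric flow pair is **fully defined over `J`** if `J ⊆ I'` (Bamler 2023, §5.1, same
Definition). [cite: Bamler2023, §5.1, Definition (Metric flow pairs and isometries)] -/
def FullyDefinedOver (P : FlowPair.{u} I) (J : Set ℝ) : Prop :=
  J ⊆ P.times

/-- Each `μ_t` of a metric flow pair is a probability measure. [cite: Bamler2023, §5.1, Definition (Metric flow pairs and isometries)] -/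
theorem isProbabilityMeasure_μ (P : FlowPair.{u} I) (t : P.times) : IsProbabilityMeasure (P.μ t) :=
  P.isConjugateHeatFlow.1 t (mem_univ _)

/-- **The one-point metric flow pair** over `I`: the one-point flow `MetricFlow.point I` over all
of `I` with `μ_t = δ` (a conjugate heat flow of full support). Witnesses that the definition is
inhabited. [folklore] -/
def point (I : Set ℝ) : FlowPair.{0} I where
  times := I
  times_subset := Subset.rfl
  volume_diff := by simp
  flow := MetricFlow.point I
  μ _ := Measure.dirac PUnit.unit
  isConjugateHeatFlow :=
    ⟨fun _ _ ↦ Measure.dirac.isProbabilityMeasure, fun s t _ _ _ S _ ↦ by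
      change Measure.dirac PUnit.unit S =
        ∫⁻ _x, Measure.dirac PUnit.unit S ∂(Measure.dirac PUnit.unit : Measure PUnit)
      rw [lintegral_dirac]⟩
  full_support t x r hr := by
    cases x
    change 0 < Measure.dirac PUnit.unit (Metric.ball PUnit.unit r)
    rw [Measure.dirac_apply_of_mem (Metric.mem_ball_self hr)]
    exact one_pos

/-- The one-point pair is fully defined over every `J ⊆ I`. [folklore] -/
theorem point_fullyDefinedOver {I J : Set ℝ} (h : J ⊆ I) : (point I).FullyDefinedOver J := h

end FlowPair

/-- **Correspondence** between two metric flows `𝒳¹` over `I¹` and `𝒳²` over `I²` (Bamler 2023,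
§5.1, Def. (Correspondence), the case of two flows: "a pair
`ℭ := ((Z_t, d^Z_t)_{t ∈ I''}, (φ^i_t)_{t ∈ I''^{,i}, i = 1, 2})` where (1) `(Z_t, d^Z_t)` is a metric
space for any `t ∈ I''`; (2) `I''^{,i} ⊂ I'^{,i} ∩ I''`; (3) `φ^i_t : (𝒳^i_t, d^i_t) → (Z_t, d^Z_t)`
is an isometric embedding for any `i` and `t ∈ I''^{,i}`"). Design: the comparison spaces `Z_t` are
indexed by all `t : ℝ` (those with `t ∉ I''` are never used), so that the set `I''` over which the
correspondence is considered is a parameter of the `𝔽`-distance below rather than a field; the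
domains `dom_i = I''^{,i} ⊆ I^i` of the embeddings are fields. The `Z_t` carry their Borel
σ-algebra (needed to push measures forward). [cite: Bamler2023, §5.1, Definition (Correspondence)] -/
structure Correspondence {I₁ I₂ : Set ℝ} (𝒳₁ : MetricFlow.{u} I₁) (𝒳₂ : MetricFlow.{u} I₂) :
    Type (u + 1) where
  /-- The comparison metric spaces `(Z_t, d^Z_t)`. -/
  Z : ℝ → Type u
  /-- Each `Z_t` is a metric space … -/
  [instMetricSpace : ∀ t, MetricSpace (Z t)]
  /-- … with a σ-algebra … -/
  [instMeasurableSpace : ∀ t, MeasurableSpace (Z t)]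
  /-- … which is its Borel σ-algebra. -/
  [instBorelSpace : ∀ t, BorelSpace (Z t)]
  /-- The times `I''^{,1} ⊆ I¹` at which `φ¹_t` is defined. -/
  dom₁ : Set ℝ
  /-- The times `I''^{,2} ⊆ I²` at which `φ²_t` is defined. -/
  dom₂ : Set ℝ
  /-- `I''^{,1} ⊆ I¹`. -/
  dom₁_subset : dom₁ ⊆ I₁
  /-- `I''^{,2} ⊆ I²`. -/
  dom₂_subset : dom₂ ⊆ I₂
  /-- The embeddings `φ¹_t : 𝒳¹_t → Z_t` … -/
  φ₁ : ∀ t : dom₁, 𝒳₁.Slice ⟨t, dom₁_subset t.2⟩ → Z t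
  /-- The embeddings `φ²_t : 𝒳²_t → Z_t` … -/
  φ₂ : ∀ t : dom₂, 𝒳₂.Slice ⟨t, dom₂_subset t.2⟩ → Z t
  /-- … are isometric embeddings. -/
  isometry_φ₁ : ∀ t, Isometry (φ₁ t)
  /-- … are isometric embeddings. -/
  isometry_φ₂ : ∀ t, Isometry (φ₂ t)

attribute [instance] Correspondence.instMetricSpace Correspondence.instMeasurableSpace
  Correspondence.instBorelSpace

namespace Correspondence

variable {I₁ I₂ : Set ℝ} {𝒳₁ : MetricFlow.{u} I₁} {𝒳₂ : MetricFlow.{u} I₂}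

/-- A correspondence is **fully defined over `J`** if `J ⊆ I''^{,1} ∩ I''^{,2}` (Bamler 2023,
§5.1, Def. (Correspondence)). [cite: Bamler2023, §5.1, Definition (Correspondence)] -/
def FullyDefinedOver (𝒞 : Correspondence 𝒳₁ 𝒳₂) (J : Set ℝ) : Prop :=
  J ⊆ 𝒞.dom₁ ∩ 𝒞.dom₂

end Correspondence

variable {I₁ I₂ : Set ℝ}

/-- **`𝔽`-distance within a correspondence, uniform over `J`** (Bamler 2023, §5.1,
Def. (`𝔽`-distance within correspondence)):
`d_𝔽^{ℭ,J}((𝒳¹, (μ¹_t)), (𝒳², (μ²_t)))` is "the infimum over all `r > 0` with the property that there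
is a measurable subset `E ⊂ I''` with `J ⊂ I'' ∖ E ⊂ I''^{,1} ∩ I''^{,2}` and a family of couplings
`(q_t)_{t ∈ I'' ∖ E}` between `μ¹_t, μ²_t` such that: (1) `|E| ≤ r²`. (2) For all `s, t ∈ I'' ∖ E`,
`s ≤ t`, we have
`∫_{𝒳¹_t × 𝒳²_t} d_{W₁}^{Z_s}((φ¹_s)_* ν¹_{x¹;s}, (φ²_s)_* ν²_{x²;s}) dq_t(x¹, x²) ≤ r`", a value in
`[0, ∞]` ("we allow `d_𝔽^{ℭ,J}` to attain the value `∞`"). The measure families `μ^i` are indexed by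
all of `I^i`; `I''` (the set over which `ℭ` is considered) and `J` are parameters.
[cite: Bamler2023, §5.1, Definition (F-distance within correspondence)] -/
def FDistWithin {𝒳₁ : MetricFlow.{u} I₁} {𝒳₂ : MetricFlow.{u} I₂} (𝒞 : Correspondence 𝒳₁ 𝒳₂)
    (I'' J : Set ℝ) (μ₁ : ∀ t : I₁, Measure (𝒳₁.Slice t)) (μ₂ : ∀ t : I₂, Measure (𝒳₂.Slice t)) :
    ℝ≥0∞ :=
  ⨅ (r : ℝ≥0∞) (_ : ∃ (E : Set ℝ) (_ : MeasurableSet E) (_ : E ⊆ I'') (_ : J ⊆ I'' \ E)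
      (hE : I'' \ E ⊆ 𝒞.dom₁ ∩ 𝒞.dom₂) (_ : volume E ≤ r ^ 2)
      (q : ∀ t : ↥(I'' \ E),
        Measure (𝒳₁.Slice ⟨t, 𝒞.dom₁_subset (hE t.2).1⟩ × 𝒳₂.Slice ⟨t, 𝒞.dom₂_subset (hE t.2).2⟩)),
      (∀ t : ↥(I'' \ E), IsCoupling (μ₁ ⟨t, 𝒞.dom₁_subset (hE t.2).1⟩)
        (μ₂ ⟨t, 𝒞.dom₂_subset (hE t.2).2⟩) (q t)) ∧
      ∀ (s t : ↥(I'' \ E)), (s : ℝ) ≤ t →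
        ∫⁻ p, wassersteinW1
            ((𝒳₁.condKernel p.1 ⟨s, 𝒞.dom₁_subset (hE s.2).1⟩).map (𝒞.φ₁ ⟨s, (hE s.2).1⟩))
            ((𝒳₂.condKernel p.2 ⟨s, 𝒞.dom₂_subset (hE s.2).2⟩).map (𝒞.φ₂ ⟨s, (hE s.2).2⟩))
          ∂(q t) ≤ r), r

/-- **The `𝔽`-distance, uniform over `J`** between two metric flows with measure families,
compared over the set of times `I''` (Bamler 2023, §5.1, Def. (`𝔽`-distance): "the infimum of
`d_𝔽^{ℭ,J}` over all correspondences `ℭ` between `𝒳¹, 𝒳²` over `I` that are fully defined over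
`J`" — correspondences not fully defined over `J` contribute `∞` to the infimum by the previous
definition, so the infimum here runs over all correspondences). For metric flow pairs over a
common interval `I` one takes `I'' = I` (`FlowPair.fdist`); `J = ∅` gives `d_𝔽`, `J = {t₀}` gives
`d_𝔽^{t₀}`. The comparison spaces range over metric spaces in the universe of the slices (for
separable slices nothing is lost: one may replace `Z_t` by the closure of the two images).
[cite: Bamler2023, §5.1, Definition (F-distance)] -/
def FDist (𝒳₁ : MetricFlow.{u} I₁) (μ₁ : ∀ t : I₁, Measure (𝒳₁.Slice t)) (𝒳₂ : MetricFlow.{u} I₂)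
    (μ₂ : ∀ t : I₂, Measure (𝒳₂.Slice t)) (I'' J : Set ℝ) : ℝ≥0∞ :=
  ⨅ 𝒞 : Correspondence 𝒳₁ 𝒳₂, FDistWithin 𝒞 I'' J μ₁ μ₂

/-- The `𝔽`-distance `d_𝔽^J` between two metric flow pairs over the same `I` (Bamler 2023, §5.1,
Def. (`𝔽`-distance)); it descends to the metric `d_𝔽^J` on `𝔽_I^J` (§5.2, Theorem: a metric if
infinite distances are allowed). [cite: Bamler2023, §5.1, Definition (F-distance)] -/
def FlowPair.fdist (P₁ P₂ : FlowPair.{u} I) (J : Set ℝ) : ℝ≥0∞ :=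
  FDist P₁.flow P₁.μ P₂.flow P₂.μ I J

/-- **`𝔽`-convergence of metric flow pairs over `I`, uniform over `J`**: `d_𝔽^J → 0` (Bamler
2023, §5.1–5.2: convergence in the metric space `(𝔽_I^J, d_𝔽^J)`; by §6.2, Theorem
(`𝔽`-convergence implies `𝔽`-convergence within a correspondence) this is equivalent to the
notion of §6.1). [cite: Bamler2023, §5.2, Theorem ((F_I^J, d_F^J) is a metric space)] -/
def FlowPair.FConverges (P : ℕ → FlowPair.{u} I) (P₀ : FlowPair.{u} I) (J : Set ℝ) : Prop :=
  Tendsto (fun i ↦ (P i).fdist P₀ J) atTop (𝓝 0)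

end FDistance

/-! ### §6.8: tangent flows -/

section TangentFlow

variable (𝒳 : MetricFlow.{u} I)

/-- **Tangent flow of a metric flow at a point** (Bamler 2023, §6.8, Def. (Tangent flow): "Let `𝒳`
be a metric flow over some `I' ⊂ ℝ` and `x₀ ∈ 𝒳_{t₀}` a point. We say that a metric flow pair
`(𝒳^∞, (ν^∞_{x_max;t})_{t ∈ I'^{,∞}}) ∈ 𝔽*_{(−∞,0]}` is a tangent flow of `𝒳` at `x₀` if there is a
sequence of scales `λ_k → ∞` such that for any `T > 0` the parabolic rescalings
`(𝒳^{−t₀,λ_k}_{[−T,0]}, (ν^{−t₀,λ_k}_{x₀;t})_{λ_k^{−2}t + t₀ ∈ I', t ∈ [−T,0]})` `𝔽`-converge to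
`(𝒳^∞_{[−T,0]}, (ν^∞_{x_max;t})_{t ∈ I'^{,∞} ∩ [−T,0]})`"). Here: `𝒯` is a metric flow pair over
`(−∞, 0]` fully defined at `0` whose time-`0` slice is a single point `x_max` with
`μ_t = ν_{x_max;t}` (membership in `𝔽*_{(−∞,0]}`, §5.1, Def. (Spaces of metric flow pairs) and the
Remark following it), and the convergence is `d_𝔽 → 0` for the distance compared over
`I'' = [−T, 0]` (`J = ∅`; for classes in `𝔽*` this equals `d_𝔽^{0}`, §5.1, Lemma) between the
rescaled flow `𝒳^{−t₀,λ_k}` with the kernels of `x₀` and `𝒯` — restriction to `[−T, 0]` being built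
into `FDist`. With `λ_k → 0` instead one obtains tangent flows at infinity (`IsTangentFlowAtInfinity`).
[cite: Bamler2023, §6.8, Definition (Tangent flow)] -/
structure IsTangentFlowAt {t₀ : I} (x₀ : 𝒳.Slice t₀) (𝒯 : FlowPair.{u} (Iic (0 : ℝ))) : Prop where
  /-- `𝒯` is fully defined at the final time `0`, -/
  zero_mem : (0 : ℝ) ∈ 𝒯.times
  /-- `𝒯_0 = {x_max}` … -/
  subsingleton_zero : Subsingleton (𝒯.flow.Slice ⟨0, zero_mem⟩)
  /-- … (exactly one point `x_max`) … -/
  nonempty_zero : Nonempty (𝒯.flow.Slice ⟨0, zero_mem⟩)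
  /-- … and `μ_t = ν_{x_max;t}`. -/
  μ_eq : ∀ (x : 𝒯.flow.Slice ⟨0, zero_mem⟩) (t : 𝒯.times), 𝒯.μ t = 𝒯.flow.condKernel x t
  /-- scales `λ_k → ∞` along which the rescalings based at `x₀` converge to `𝒯` on every `[−T, 0]`. -/
  exists_scales : ∃ (la : ℕ → ℝ) (hla : ∀ k, 0 < la k), Tendsto la atTop atTop ∧
    ∀ T : ℝ, 0 < T →
      Tendsto (fun k ↦ FDist (𝒳.rescale t₀ (la k) (hla k))
        (fun t' ↦ (𝒳.condKernel x₀ (origTime (hla k) t') : Measure (𝒳.Slice (origTime (hla k) t'))))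
        𝒯.flow 𝒯.μ (Icc (-T) 0) ∅) atTop (𝓝 0)

/-- **Tangent flow at infinity** (Bamler 2023, §6.8, Def. (Tangent flow): "If `λ_k → 0` instead of
`λ_k → ∞`, then we call `(𝒳^∞, (ν^∞_{x_max;t})) ∈ 𝔽*_{(−∞,0]}` a tangent flow of `𝒳` at infinity").
[cite: Bamler2023, §6.8, Definition (Tangent flow)] -/
structure IsTangentFlowAtInfinity {t₀ : I} (x₀ : 𝒳.Slice t₀) (𝒯 : FlowPair.{u} (Iic (0 : ℝ))) :
    Prop where
  /-- `𝒯` is fully defined at the final time `0`, -/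
  zero_mem : (0 : ℝ) ∈ 𝒯.times
  /-- `𝒯_0 = {x_max}` … -/
  subsingleton_zero : Subsingleton (𝒯.flow.Slice ⟨0, zero_mem⟩)
  /-- … (exactly one point `x_max`) … -/
  nonempty_zero : Nonempty (𝒯.flow.Slice ⟨0, zero_mem⟩)
  /-- … and `μ_t = ν_{x_max;t}`. -/
  μ_eq : ∀ (x : 𝒯.flow.Slice ⟨0, zero_mem⟩) (t : 𝒯.times), 𝒯.μ t = 𝒯.flow.condKernel x t
  /-- scales `λ_k → 0` along which the rescalings based at `x₀` converge to `𝒯` on every `[−T, 0]`. -/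
  exists_scales : ∃ (la : ℕ → ℝ) (hla : ∀ k, 0 < la k), Tendsto la atTop (𝓝 0) ∧
    ∀ T : ℝ, 0 < T →
      Tendsto (fun k ↦ FDist (𝒳.rescale t₀ (la k) (hla k))
        (fun t' ↦ (𝒳.condKernel x₀ (origTime (hla k) t') : Measure (𝒳.Slice (origTime (hla k) t'))))
        𝒯.flow 𝒯.μ (Icc (-T) 0) ∅) atTop (𝓝 0)

end TangentFlow

/-! ### §9.2: regular points, the regular and the singular part -/

section RegularPart

open Lorentzian

/-- A set of times is **left-open** if it has no least element ("left-open subinterval" of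
Bamler 2023, §9.2). [folklore] -/
def IsLeftOpenTimes (S : Set ℝ) : Prop :=
  ∀ t ∈ S, ∃ s ∈ S, s < t

/-- A set of times is **right-open** if it has no greatest element ("right-open subinterval" of
Bamler 2023, §9.2). [folklore] -/
def IsRightOpenTimes (S : Set ℝ) : Prop :=
  ∀ t ∈ S, ∃ s ∈ S, t < s

variable (𝒳 : MetricFlow.{u} I)

open scoped Classical in
/-- The pull-back `u'_t := u_t ∘ φ_t` of a family of functions on the time-slices along slice maps
`φ_t : M' → 𝒳_t` defined for `t ∈ I' ⊆ I` (and `0` at times `t ∉ I'`). [cite: Bamler2023, §9.2, Definition (Regular points), (4)] -/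
def slicePullback {I' : Set ℝ} (hI' : I' ⊆ I) {M' : Type*} (φ : ∀ t : I', M' → 𝒳.Slice ⟨t, hI' t.2⟩)
    (u : ∀ t : I, 𝒳.Slice t → ℝ) (t : ℝ) (m : M') : ℝ :=
  if h : t ∈ I' then u ⟨t, hI' h⟩ (φ ⟨t, h⟩ m) else 0

/-- **Regular chart at a point `x` of a metric flow** — the data in Bamler's definition of a
regular point (Bamler 2023, §9.2, Def. (Regular points): "A point `x ∈ 𝒳` is called regular if
there is a manifold `M'`, a subinterval `I' ⊂ I` that is a neighborhood of `𝔱(x)` in `I`, a Ricci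
flow `(M', (g'_t)_{t ∈ I'})` and map `φ : M' × I' → 𝒳` such that the following holds: (1)
`x ∈ φ(M' × I')`. (2) `φ` is a homeomorphism onto its image and the image `φ(M' × I')` is open in
`𝒳`. Here we consider the natural topology on `𝒳`. (3) For any `t ∈ I'` we have
`φ_t(M') ⊂ 𝒳_t` and `φ_t : (M', d_{g'_t}) → (𝒳_t, d_t)` is a local isometry. (4) For any uniformly
bounded heat flow `(u_t)_{t ∈ Ĩ}` on `𝒳` over a left-open subinterval `Ĩ ⊂ I'`, the family of
functions `(u'_t := u_t ∘ φ_t)_{t ∈ Ĩ}` is a smooth solution to the heat equation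
`□u' = (∂_t − Δ_{g'_t}) u' = 0` on `M'` with background metric `g'_t`. (5) For any conjugate heat
flow `(μ_t)_{t ∈ Ĩ}` on `𝒳` over a right-open subinterval `Ĩ ⊂ I'`, we have `φ_t^* μ_t = v'_t dg'_t`
for all `t ∈ Ĩ`, where `v' ∈ C^∞(M' × Ĩ)` is a smooth solution to the conjugate heat equation
`□* v' = (−∂_t − Δ_{g'_t} + R) v' = 0`"). In the tree's vocabulary: `M'` is a `C^∞` manifold
modelled on `ℝⁿ` (`n = dim x`, "local dimension"), the Ricci flow is
`Literature.Geometry.Riemannian.IsRicciFlow g' cov' I'` (Riemannian, `RicciFlow.lean`), the length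
metric `d_{g'_t}` is `PseudoRiemannianMetric.edist` (`RiemannianDistance.lean`), `Δ_{g'_t}` is
`PseudoRiemannianMetric.laplaceBeltrami`, `R` is `scalarCurvatureWith (cov' t)`, `dg'_t` is
`Lorentzian.riemannianMeasure`, `φ_t^*` is `Measure.comap (φ t)`, the open embedding is with
respect to `MetricFlow.naturalTopology`, and time derivatives are taken within `Ĩ`
(`HasDerivWithinAt`), as in `IsRicciFlow`. [cite: Bamler2023, §9.2, Definition (Regular points)] -/
structure RegularChart (x : 𝒳.Pt) {n : ℕ} (M' : Type u) [TopologicalSpace M'] [T3Space M']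
    [SecondCountableTopology M'] [ChartedSpace (EuclideanSpace ℝ (Fin n)) M']
    [IsManifold (𝓡 n) ∞ M'] [MeasurableSpace M'] [BorelSpace M'] (I' : Set ℝ)
    (g' : ℝ → PseudoRiemannianMetric (𝓡 n) ∞ (EuclideanSpace ℝ (Fin n))
      (TangentSpace (𝓡 n) : M' → Type))
    (cov' : ℝ → CovariantDerivative (𝓡 n) (EuclideanSpace ℝ (Fin n))
      (TangentSpace (𝓡 n) : M' → Type)) : Type u where
  /-- `I' ⊆ I` … -/
  times_subset : I' ⊆ I
  /-- … is a subinterval … -/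
  ordConnected_times : I'.OrdConnected
  /-- … and a neighbourhood of `𝔱(x)` in `I`. -/
  times_mem_nhdsWithin : I' ∈ 𝓝[I] (x.1 : ℝ)
  /-- `(M', (g'_t)_{t ∈ I'})` is a Ricci flow (of Riemannian metrics, Levi-Civita witnesses `cov'`). -/
  isRicciFlow : IsRicciFlow g' cov' I'
  /-- The metrics `g'_t`, `t ∈ I'`, are Riemannian. -/
  isRiemannian : ∀ t ∈ I', (g' t).IsRiemannian
  /-- The slice maps `φ_t : M' → 𝒳_t` of `φ : M' × I' → 𝒳`. -/
  φ : ∀ t : I', M' → 𝒳.Slice ⟨t, times_subset t.2⟩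
  /-- (1) `x ∈ φ(M' × I')`. -/
  mem_range : ∃ (t : I') (m : M'), (⟨⟨t, times_subset t.2⟩, φ t m⟩ : 𝒳.Pt) = x
  /-- (2) `φ` is a homeomorphism onto an open image, for the natural topology of `𝒳`. -/
  isOpenEmbedding : @Topology.IsOpenEmbedding (M' × I') 𝒳.Pt _ 𝒳.naturalTopology
    fun p ↦ ⟨⟨p.2, times_subset p.2.2⟩, φ p.2 p.1⟩
  /-- (3) each `φ_t : (M', d_{g'_t}) → (𝒳_t, d_t)` is a local isometry. -/
  locallyIsometric : ∀ (t : I') (m : M'), ∃ U ∈ 𝓝 m, ∀ m₁ ∈ U, ∀ m₂ ∈ U,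
    edist (φ t m₁) (φ t m₂) = (g' t).edist (isRiemannian t t.2) m₁ m₂
  /-- (4) uniformly bounded heat flows over left-open subintervals `Ĩ ⊆ I'` pull back to smooth
  solutions of the heat equation `∂_t u' = Δ_{g'_t} u'`. -/
  heatFlow_pullback : ∀ (J : Set ℝ), J ⊆ I' → J.OrdConnected → IsLeftOpenTimes J →
    ∀ u : ∀ t : I, 𝒳.Slice t → ℝ, 𝒳.IsHeatFlow J u →
      (∃ C : ℝ, ∀ t : I, (t : ℝ) ∈ J → ∀ y, |u t y| ≤ C) →
      ContMDiffOn ((𝓡 n).prod 𝓘(ℝ, ℝ)) 𝓘(ℝ, ℝ) ∞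
          (fun p : M' × ℝ ↦ 𝒳.slicePullback times_subset φ u p.2 p.1) (univ ×ˢ J) ∧
        ∀ t ∈ J, ∀ m : M',
          HasDerivWithinAt (fun s ↦ 𝒳.slicePullback times_subset φ u s m)
            ((g' t).laplaceBeltrami (𝒳.slicePullback times_subset φ u t) m) J t
  /-- (5) conjugate heat flows over right-open subintervals `Ĩ ⊆ I'` pull back to `v' dg'` with
  `v'` a smooth solution of the conjugate heat equation `−∂_t v' = Δ_{g'_t} v' − R v'`. -/
  conjugateHeatFlow_pullback : ∀ (J : Set ℝ) (hJ : J ⊆ I'), J.OrdConnected →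
    IsRightOpenTimes J → ∀ μ : ∀ t : I, Measure (𝒳.Slice t), 𝒳.IsConjugateHeatFlow J μ →
      ∃ v' : ℝ → M' → ℝ,
        ContMDiffOn ((𝓡 n).prod 𝓘(ℝ, ℝ)) 𝓘(ℝ, ℝ) ∞ (fun p : M' × ℝ ↦ v' p.2 p.1)
            (univ ×ˢ J) ∧
          (∀ (t : ℝ) (ht : t ∈ J), Measure.comap (φ ⟨t, hJ ht⟩) (μ ⟨t, times_subset (hJ ht)⟩) =
            (riemannianMeasure ((g' t).toContMDiffRiemannianMetric
              (isRiemannian t (hJ ht)))).withDensity fun m ↦ ENNReal.ofReal (v' t m)) ∧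
          ∀ t ∈ J, ∀ m : M',
            HasDerivWithinAt (fun s ↦ v' s m)
              (-(g' t).laplaceBeltrami (v' t) m + (g' t).scalarCurvatureWith (cov' t) m * v' t m)
              J t

/-- **Regular point** of a metric flow (Bamler 2023, §9.2, Def. (Regular points)): a point
admitting a regular chart (`RegularChart`) from some Ricci flow on some `n`-manifold over some
subinterval. The source assumes `I` is a left-open interval. [cite: Bamler2023, §9.2, Definition (Regular points)] -/
def IsRegularPoint (x : 𝒳.Pt) : Prop :=
  ∃ (n : ℕ) (M' : Type u) (_ : TopologicalSpace M') (_ : T3Space M') (_ : SecondCountableTopology M')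
    (_ : ChartedSpace (EuclideanSpace ℝ (Fin n)) M') (_ : IsManifold (𝓡 n) ∞ M')
    (_ : MeasurableSpace M') (_ : BorelSpace M') (I' : Set ℝ)
    (g' : ℝ → PseudoRiemannianMetric (𝓡 n) ∞ (EuclideanSpace ℝ (Fin n))
      (TangentSpace (𝓡 n) : M' → Type))
    (cov' : ℝ → CovariantDerivative (𝓡 n) (EuclideanSpace ℝ (Fin n))
      (TangentSpace (𝓡 n) : M' → Type)),
    Nonempty (𝒳.RegularChart x M' I' g' cov')

/-- **The regular part `ℛ ⊆ 𝒳`**: the set of regular points (Bamler 2023, §9.2, Def. (Regular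
part of a metric flow); by the Theorem preceding it, `ℛ` is open in the natural topology and
carries a unique structure of Ricci flow spacetime `(ℛ, 𝔱, ∂_𝔱, g)` — not constructed here).
[cite: Bamler2023, §9.2, Definition (Regular part of a metric flow)] -/
def regularPart : Set 𝒳.Pt :=
  {x | 𝒳.IsRegularPoint x}

/-- **The singular part `𝒮 := 𝒳 ∖ ℛ`** (Bamler 2023, §9.2, Def. (Regular part of a metric
flow)). [cite: Bamler2023, §9.2, Definition (Regular part of a metric flow)] -/
def singularPart : Set 𝒳.Pt :=
  (𝒳.regularPart)ᶜ

/-- **Local dimension** `dim x := dim M'` at a regular point (Bamler 2023, §9.2, display after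
Def. (Regular points); well defined by property (3) — here the dimension of a chosen chart).
[cite: Bamler2023, §9.2, Definition (Regular points)] -/
def localDim (x : 𝒳.Pt) (h : 𝒳.IsRegularPoint x) : ℕ :=
  Classical.choose h

/-- Membership in the regular part. [cite: Bamler2023, §9.2, Definition (Regular part of a metric flow)] -/
theorem mem_regularPart_iff (x : 𝒳.Pt) : x ∈ 𝒳.regularPart ↔ 𝒳.IsRegularPoint x := Iff.rfl

/-- Membership in the singular part. [cite: Bamler2023, §9.2, Definition (Regular part of a metric flow)] -/
theorem mem_singularPart_iff (x : 𝒳.Pt) : x ∈ 𝒳.singularPart ↔ ¬ 𝒳.IsRegularPoint x := Iff.rfl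

/-- `ℛ` and `𝒮` partition `𝒳`. [cite: Bamler2023, §9.2, Definition (Regular part of a metric flow)] -/
theorem regularPart_union_singularPart : 𝒳.regularPart ∪ 𝒳.singularPart = univ :=
  union_compl_self _

/-- **Singular times**: the times `t ∈ I` whose time-slice meets the singular part. (For a
3-dimensional singular Ricci flow the singular times are "the set of times whose time-slices are
incomplete", Bamler 2021, §4.5 — the spacetime omits the singular points, which reappear in the
metric completion of the slices; in the metric-flow picture the slices are complete and the
singular points are the points of `𝒮`.) [cite: Bamler2021Notices, §4.5 (discussion after Def. 4.10)] -/
def singularTimes : Set ℝ :=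
  {t | ∃ (ht : t ∈ I) (y : 𝒳.Slice ⟨t, ht⟩), (⟨⟨t, ht⟩, y⟩ : 𝒳.Pt) ∈ 𝒳.singularPart}

/-- Singular times are times of the flow. [folklore] -/
theorem singularTimes_subset : 𝒳.singularTimes ⊆ I := fun _ ⟨ht, _⟩ ↦ ht

/-- A time is singular iff some point of its slice is not regular. [folklore] -/
theorem mem_singularTimes_iff {t : ℝ} :
    t ∈ 𝒳.singularTimes ↔ ∃ (ht : t ∈ I) (y : 𝒳.Slice ⟨t, ht⟩), ¬ 𝒳.IsRegularPoint ⟨⟨t, ht⟩, y⟩ :=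
  Iff.rfl

end RegularPart

/-! ### Metric flows given globally by a classical Ricci flow -/

section Modelled

open Lorentzian

variable (𝒳 : MetricFlow.{u} I)

/-- **A metric flow is modelled, over `I' ⊆ I`, on the classical Ricci flow
`(M, (g_t)_{t ∈ I'})`** if there is a regular chart from `(M, g, cov)` over `I'` (Bamler 2023,
§9.2, Def. (Regular points), all five clauses) whose slice maps
`φ_t : (M, d_{g_t}) → (𝒳_t, d_t)` are moreover GLOBAL isometries (bijective and distance
preserving), so that the chart covers the whole time-slab `𝒳_{I'}`. By the Theorem of §9.2
(the spacetime structure on the regular part is uniquely determined by clauses (1)–(3)) and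
§3.7, Theorem (the metric flow of a smooth flow on a compact manifold: `d_t = d_{g_t}`,
`dν_{x,t;s} = K(x,t;·,s) dg_s`), this expresses "`𝒳_{I'}` is the metric flow of
`(M, (g_t)_{t ∈ I'})`" without constructing heat kernels; it is the predicate by which users
name smooth MODEL flows (e.g. "the tangent flow restricted to `(−∞, 0)` is the round shrinking
`S⁴`", with `shrinkingSphereFourMetric` of `ShrinkingRoundSphereFour.lean` scaled by `|t|`).
[cite: Bamler2023, §9.2, Definition (Regular points) and Theorem (regular part); §3.7, Theorem (super Ricci flows as metric flows)] -/
def IsModelledOn {n : ℕ} (M : Type u) [TopologicalSpace M] [T3Space M]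
    [SecondCountableTopology M] [ChartedSpace (EuclideanSpace ℝ (Fin n)) M]
    [IsManifold (𝓡 n) ∞ M] [MeasurableSpace M] [BorelSpace M]
    (g : ℝ → PseudoRiemannianMetric (𝓡 n) ∞ (EuclideanSpace ℝ (Fin n))
      (TangentSpace (𝓡 n) : M → Type))
    (cov : ℝ → CovariantDerivative (𝓡 n) (EuclideanSpace ℝ (Fin n))
      (TangentSpace (𝓡 n) : M → Type))
    (I' : Set ℝ) : Prop :=
  ∃ (x : 𝒳.Pt) (c : 𝒳.RegularChart x M I' g cov),
    (∀ t : I', Function.Bijective (c.φ t)) ∧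
    ∀ (t : I') (m₁ m₂ : M), edist (c.φ t m₁) (c.φ t m₂) = (g t).edist (c.isRiemannian t t.2) m₁ m₂

end Modelled

end MetricFlow

/-! ### The 4-dimensional object: a metric flow through singularities from `(M, g₀)` -/

section Four

open Lorentzian MetricFlow

/-- **Ricci flow through singularities starting from a closed Riemannian 4-manifold `(M, g₀)`,
as a metric flow** — the OBJECT of Bamler's Conjecture 5.8 (Bamler 2021, §5.6: "Given a closed
Riemannian 4-manifold `(M, g)` there is a certain kind of 'Ricci flow through singularities' in
which topological change occurs along cylinders or cones and in which time-slices are allowed to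
have isolated orbifold singularities"; §5.3: a metric flow "is some sort of Ricci flow spacetime …
that is allowed to have singular points; think, for example, of isolated orbifold singularities in
every time-slice …, or a singular point where a round shrinking sphere goes extinct"; §5.5,
Def. 5.7 and Bamler 2023, Def. 3.2 for metric flows; in dimension 3 this is Theorem 4.6 with
Defs. 4.7–4.10 of Bamler 2021 and Bamler 2023, §3.7, Theorem (singular Ricci flows as
`H₃`-concentrated metric flows)). The source gives NO precise definition in dimension 4 and
existence/uniqueness are OPEN (Conj. 5.8); accordingly this structure records only the data every
such notion shares — a metric flow `𝒳` over `[0, ∞)` (Bamler 2023, Def. 3.2, `MetricFlow`) whose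
initial time-slice `(𝒳_0, d_0)` is isometric to `(M, d_{g₀})` (the Riemannian distance
`PseudoRiemannianMetric.edist` of `g₀`; "whose initial time-slice is `(M, g)`", Thm. 4.6) — and
every further property is a HYPOTHESIS users state with the vocabulary of this file:
`MetricFlow.IsHConcentrated 𝒳.flow (concentrationConst 4)` (Bamler 2023, §3.4/§3.7),
`MetricFlow.regularPart / singularPart / singularTimes` (§9.2), `MetricFlow.IsTangentFlowAt`
(§6.8; "tangent flows are (possibly singular) gradient shrinking solitons", Bamler 2021, Thm. 5.4),
`MetricFlow.IsModelledOn` (naming smooth models such as the round shrinking `S⁴`,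
`shrinkingSphereFourMetric`), flow isometries and `𝔽`-convergence (§3.1, §5.1). Nothing is
asserted to exist. [cite: Bamler2021Notices, §5.6, Conjecture 5.8; §4.5, Theorem 4.6 and Definitions 4.7–4.10]
[cite: Bamler2023, §3.1, Def. 3.2 (metric flow); §3.7, Theorem (singular Ricci flows as metric flows)] -/
structure RicciFlowThroughSingularitiesFour (M : Type) [TopologicalSpace M]
    [ChartedSpace (EuclideanSpace ℝ (Fin 4)) M] [IsManifold (𝓡 4) ∞ M]
    (g₀ : PseudoRiemannianMetric (𝓡 4) ∞ (EuclideanSpace ℝ (Fin 4)) (TangentSpace (𝓡 4) : M → Type)) :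
    Type 1 where
  /-- The initial metric is Riemannian (needed to speak of its distance `d_{g₀}`). -/
  isRiemannian : g₀.IsRiemannian
  /-- The metric flow `𝒳` over `[0, ∞)`. -/
  flow : MetricFlow.{0} (Ici (0 : ℝ))
  /-- The identification of the initial time-slice `𝒳_0` with `M` … -/
  initial : flow.Slice ⟨0, self_mem_Ici⟩ ≃ M
  /-- … is an isometry `(𝒳_0, d_0) → (M, d_{g₀})`. -/
  edist_initial : ∀ x y : flow.Slice ⟨0, self_mem_Ici⟩,
    edist x y = g₀.edist isRiemannian (initial x) (initial y)

namespace RicciFlowThroughSingularitiesFour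

variable {M : Type} [TopologicalSpace M] [ChartedSpace (EuclideanSpace ℝ (Fin 4)) M]
  [IsManifold (𝓡 4) ∞ M]
  {g₀ : PseudoRiemannianMetric (𝓡 4) ∞ (EuclideanSpace ℝ (Fin 4)) (TangentSpace (𝓡 4) : M → Type)}

/-- The time-`t` slice `𝒳_t`, `t ≥ 0`. [cite: Bamler2023, §3.1, Def. 3.2 (metric flow)] -/
abbrev Slice (𝒳 : RicciFlowThroughSingularitiesFour M g₀) (t : ℝ) (ht : 0 ≤ t) : Type :=
  𝒳.flow.Slice ⟨t, ht⟩

/-- The points `⨆_{t ≥ 0} 𝒳_t` of the flow. [cite: Bamler2023, §3.1, Def. 3.2 (metric flow)] -/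
abbrev Pt (𝒳 : RicciFlowThroughSingularitiesFour M g₀) : Type :=
  𝒳.flow.Pt

/-- The singular times of the flow (`MetricFlow.singularTimes`). [cite: Bamler2021Notices, §4.5 (discussion after Def. 4.10)] -/
abbrev singularTimes (𝒳 : RicciFlowThroughSingularitiesFour M g₀) : Set ℝ :=
  𝒳.flow.singularTimes

/-- The singular part `𝒮` of the flow (`MetricFlow.singularPart`). [cite: Bamler2023, §9.2, Definition (Regular part of a metric flow)] -/
abbrev singularPart (𝒳 : RicciFlowThroughSingularitiesFour M g₀) : Set 𝒳.Pt :=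
  𝒳.flow.singularPart

/-- Tangent flows of the flow at a point `x ∈ 𝒳_t` (`MetricFlow.IsTangentFlowAt`). [cite: Bamler2023, §6.8, Definition (Tangent flow)] -/
abbrev IsTangentFlowAt (𝒳 : RicciFlowThroughSingularitiesFour M g₀) {t : ℝ} {ht : 0 ≤ t}
    (x : 𝒳.Slice t ht) (𝒯 : FlowPair.{0} (Iic (0 : ℝ))) : Prop :=
  𝒳.flow.IsTangentFlowAt x 𝒯

/-- `H₄`-concentration of the flow (`MetricFlow.IsHConcentrated` with `H₄ = 3π²/2 + 4`; smooth and
3-dimensional singular Ricci flows are `H_n`-concentrated, Bamler 2023, §3.7 — in dimension 4 a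
hypothesis). [cite: Bamler2023, §3.4, Definition (H-Concentration); §3.7, Theorem (super Ricci flows as metric flows)] -/
abbrev IsH4Concentrated (𝒳 : RicciFlowThroughSingularitiesFour M g₀) : Prop :=
  𝒳.flow.IsHConcentrated (concentrationConst 4)

/-- Singular times are non-negative. [folklore] -/
theorem singularTimes_subset_Ici (𝒳 : RicciFlowThroughSingularitiesFour M g₀) :
    𝒳.singularTimes ⊆ Ici 0 :=
  𝒳.flow.singularTimes_subset

/-- The initial identification preserves distances (restated with `dist`-free `edist`).
[cite: Bamler2021Notices, §4.5, Theorem 4.6] -/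
theorem edist_initial_symm_apply (𝒳 : RicciFlowThroughSingularitiesFour M g₀) (m₁ m₂ : M) :
    g₀.edist 𝒳.isRiemannian m₁ m₂ = edist (𝒳.initial.symm m₁) (𝒳.initial.symm m₂) := by
  rw [𝒳.edist_initial, Equiv.apply_symm_apply, Equiv.apply_symm_apply]

end RicciFlowThroughSingularitiesFour

end Four

end Literature.Geometry.Riemannian

end
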